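import Summits.AtomisticToContinuum.HydrodynamicLimit.Theorems.AntiMazurCoboundariesCellForecastPressureDecayClusterTailFirstOrder
import Literature.Analysis.FluidPDE.HardSphereCollisionTimeMeasurable
import HarnessLib

/-!
# S2e-2 · the short-time cluster tail: non-fresh first contacts are second order
# (registered sub-goal `stub_clusterTail_nonFresh` of stub `stub_clusterTail`, crux line
# `enskog-compensator-martingale`, crux `CellForecastPressureDecay`, stmt-AtomisticToContinuum-13915)

Under the canonical cell law `P_{n,L}` (`n ≤ 2L³`, `σ ≤ 3/16`, `L ≥ 1`), the expected number of spheres `i` that are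
free on `(0, s)` and collide at a time `s ≤ Δ` with a sphere `j` which ALREADY took part in a collision before `s` is
`≤ C (L³Δ² + L²Δ)` (`stub_clusterTail_nonFresh`, the event T2 of the cluster tail). Same particle-removal charging
as the first-order bound (`eventually_exists_grid_charge`, `lintegral_chargingTerm_le`), with the bath weight
"`j` is not free in the slab for the `m`-sphere flow of the data WITHOUT `i`" (a collision of `j` before the first
contact of `i` is a collision of the bath, `participates_bath_of_participates`; the event is measurable on the
good set, `HardSphereFlow.measurableSet_lt_ncard_collisionTimesOf_window`). THE KEY STEP: the set of non-free
spheres of the bath is closed under the collisions of the slab, so its kinetic energy is conserved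
(`stub_kinematicAssembly_clusterEnergy`) and `∑_{j not free} ‖w − Vⱼ(a)‖ ≤ (‖w‖ + 1) ∑_{j not free} (1 + ‖vⱼ‖²)`
— the integrand of the weighted first-order bound `stub_clusterTail_firstOrder` for the `m`-system, which is
`O(L³Δ)`; with the factor `σ² Δ / L³` of the charging and the `m + 1 ≤ 2L³` labels this is `O(L³ Δ²)`.

References: Cercignani–Illner–Pulvirenti 1994, §2.2, App. 4.A; Gallagher–Saint-Raymond–Texier 2013, §4.1.
-/

noncomputable section

open MeasureTheory ProbabilityTheory Set Filter Topology
open scoped ENNReal BigOperators InnerProductSpace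
open Literature.Analysis.FluidPDE Literature.MathematicalPhysics.KineticTheory

namespace Summit.AtomisticToContinuum.HydrodynamicLimit.Theorems.EnskogCompensator

variable {σ L : ℝ} {m : ℕ}

/-! ## A collision of the partner before the first contact is a collision of the bath -/

/-- **A collision of the partner before the first contact is a collision of the bath.** If `i` takes part in
no collision at the times of `(0, τ)` and the sphere `i.succAbove j` participates in a collision at a time
`s ∈ (0, τ)` of the `(m+1)`-sphere flow, then the bath sphere `j` participates in a collision at time `s` of the
`m`-sphere flow of the data with `i` removed (removal identity on `[0, τ)`; the partner of `i.succAbove j` at `s`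
is not `i`). [cite: GST2013, §4.1] -/
theorem participates_bath_of_participates (Ψ : Flows σ) {z : Cell (m + 1)} (hz : z ∈ (Ψ (m + 1)).good)
    {i : Fin (m + 1)} (hz' : (fun c => z (i.succAbove c)) ∈ (Ψ m).good) {τ : ℝ}
    (hnp : ∀ s ∈ Set.Ioo 0 τ, ¬ Participates (Euclidean.geometry (Fin 3)) σ ((Ψ (m + 1)).flow s z) i)
    {s : ℝ} (hs : s ∈ Set.Ioo 0 τ) {j : Fin m}
    (hj : Participates (Euclidean.geometry (Fin 3)) σ ((Ψ (m + 1)).flow s z) (i.succAbove j)) :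
    Participates (Euclidean.geometry (Fin 3)) σ ((Ψ m).flow s (fun c => z (i.succAbove c))) j := by
  have hγ := (Ψ (m + 1)).isTrajectory z hz
  have hrem : (fun c => (Ψ (m + 1)).flow s z (i.succAbove c)) = (Ψ m).flow s (fun c => z (i.succAbove c)) :=
    (stub_clusterTail_removal σ m Ψ τ).1 z i hz hz' hnp s ⟨hs.1.le, hs.2⟩
  obtain ⟨k, hk⟩ := hj
  have hki : k ≠ i := by
    rintro rfl
    exact hnp s hs ⟨_, hk.symm⟩
  obtain ⟨k', rfl⟩ := Fin.exists_succAbove_eq hki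
  have hdom := hγ.mem s
  rw [← hrem]
  rcases hk with hk | hk
  · obtain ⟨hne, hc'⟩ := mem_contactPairs.1 hk
    refine ⟨k', Or.inl (mem_contactPairs.2 ⟨fun h => hne (congrArg i.succAbove h), ?_⟩)⟩
    exact (comp_mem_contactSet_iff Fin.succAbove_right_injective hdom).2 hc'
  · obtain ⟨hne, hc'⟩ := mem_contactPairs.1 hk
    refine ⟨k', Or.inr (mem_contactPairs.2 ⟨fun h => hne (congrArg i.succAbove h), ?_⟩)⟩
    exact (comp_mem_contactSet_iff Fin.succAbove_right_injective hdom).2 hc'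

/-! ## The non-free spheres of the bath: measurability and energy -/

/-- **"Sphere `j` is not free in the slab" is a measurable event** (guarded by the good set): the set of data of the
`m`-sphere flow that are good and along whose orbit `j` has at least one collision time in `(0, Δ]` is measurable
(`HardSphereFlow.measurableSet_lt_ncard_collisionTimesOf_window` on the good subtype; the good set is measurable).
[folklore] -/
theorem measurableSet_good_and_ncard_pos (Ψ : Flows σ) (m : ℕ) (j : Fin m) (Δ : ℝ) :
    MeasurableSet {z' : Cell m | z' ∈ (Ψ m).good ∧
      0 < (collisionTimesOf (Euclidean.geometry (Fin 3)) σ (fun s => (Ψ m).flow s z') j ∩ Set.Ioc 0 Δ).ncard} := by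
  have hGc : Continuous fun p : V3 × V3 => ‖(Euclidean.geometry (Fin 3)).sepVec p.1 p.2‖ :=
    continuous_norm.comp (continuous_fst.sub continuous_snd)
  have himage : {z' : Cell m | z' ∈ (Ψ m).good ∧
      0 < (collisionTimesOf (Euclidean.geometry (Fin 3)) σ (fun s => (Ψ m).flow s z') j ∩ Set.Ioc 0 Δ).ncard} =
      Subtype.val '' {z' : (Ψ m).good | 0 < (collisionTimesOf (Euclidean.geometry (Fin 3)) σ
        (fun s => (Ψ m).flow s (z' : Cell m)) j ∩ Set.Ioc 0 Δ).ncard} := by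
    ext z'
    simp only [mem_setOf_eq, mem_image, Subtype.exists, exists_and_right, exists_eq_right]
    exact ⟨fun ⟨hz, hK⟩ => ⟨hz, hK⟩, fun ⟨hz, hK⟩ => ⟨hz, hK⟩⟩
  rw [himage]
  exact (Ψ m).measurableSet_good.subtype_image
    ((Ψ m).measurableSet_lt_ncard_collisionTimesOf_window hGc Euclidean.measurable_geometry_sepVec j Δ 0)

/-- On the good set, `j` is not free in the slab iff it has a collision time in `(0, Δ]` (the collision times of a
good orbit in a bounded window are finitely many). [folklore] -/
theorem not_isFreeIn_iff_ncard_pos (Ψ : Flows σ) {z' : Cell m} (hz' : z' ∈ (Ψ m).good) (j : Fin m) (Δ : ℝ) :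
    ¬ IsFreeIn Ψ Δ z' j ↔
      0 < (collisionTimesOf (Euclidean.geometry (Fin 3)) σ (fun s => (Ψ m).flow s z') j ∩ Set.Ioc 0 Δ).ncard := by
  have hfin : (collisionTimesOf (Euclidean.geometry (Fin 3)) σ (fun s => (Ψ m).flow s z') j ∩ Set.Ioc 0 Δ).Finite :=
    (((Ψ m).isTrajectory z' hz').locFinite 0 Δ).subset
      (inter_subset_inter (collisionTimesOf_subset _ j) Ioc_subset_Icc_self)
  rw [Set.ncard_pos hfin, IsFreeIn]
  push Not
  exact ⟨fun ⟨s, hs, hp⟩ => ⟨s, hp, hs⟩, fun ⟨s, hp, hs⟩ => ⟨s, hs, hp⟩⟩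

open Classical in
/-- **The non-free spheres of the bath carry their own initial energy.** On the good set of the `m`-sphere flow, for
`t ∈ [0, Δ]` and every `w`: `∑_{j not free in (0,Δ]} ‖w − Vⱼ(t)‖ ≤ (‖w‖ + 1) ∑_{j not free} (1 + ‖vⱼ‖²)` — the set of
non-free spheres is closed under the collisions of the slab (both partners of a collision are non-free), so its
kinetic energy at time `t` is its initial one (`stub_kinematicAssembly_clusterEnergy`), and `‖V‖ ≤ 1 + ‖V‖²`.
[cite: GST2013, §1.1] -/
theorem sum_indicator_norm_sub_vel_le (Ψ : Flows σ) {z' : Cell m} (hz' : z' ∈ (Ψ m).good) {Δ t : ℝ}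
    (ht : t ∈ Set.Icc 0 Δ) (w : V3) :
    ∑ j : Fin m, {z' : Cell m | z' ∈ (Ψ m).good ∧
        0 < (collisionTimesOf (Euclidean.geometry (Fin 3)) σ (fun s => (Ψ m).flow s z') j ∩ Set.Ioc 0 Δ).ncard}.indicator
          1 z' * ENNReal.ofReal ‖w - ((Ψ m).flow t z' j).2‖ ≤
      ENNReal.ofReal (‖w‖ + 1) * ∑ j : Fin m, (if IsFreeIn Ψ Δ z' j then 0 else ENNReal.ofReal (1 + ‖(z' j).2‖ ^ 2)) := by
  set B : Finset (Fin m) := Finset.univ.filter fun j => ¬ IsFreeIn Ψ Δ z' j with hB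
  -- `B` is closed under the collisions of the slab
  have hclosed : ∀ s ∈ Set.Ioc 0 Δ, ∀ p q : Fin m, p ≠ q →
      (Ψ m).flow s z' ∈ contactSet (Euclidean.geometry (Fin 3)) m σ p q → (p ∈ B ↔ q ∈ B) := by
    intro s hs p q hpq hc
    have hpq' : (p, q) ∈ contactPairs (Euclidean.geometry (Fin 3)) σ ((Ψ m).flow s z') := mem_contactPairs.2 ⟨hpq, hc⟩
    have hp : ¬ IsFreeIn Ψ Δ z' p := fun h => h s hs ⟨q, Or.inl hpq'⟩
    have hq : ¬ IsFreeIn Ψ Δ z' q := fun h => h s hs ⟨p, Or.inr hpq'⟩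
    simp [hB, hp, hq]
  have henergy := (stub_kinematicAssembly_clusterEnergy σ m Ψ z' hz' B Δ hclosed t ht).1
  -- both sides are sums over `B`
  have hlhs : ∑ j : Fin m, {z' : Cell m | z' ∈ (Ψ m).good ∧
      0 < (collisionTimesOf (Euclidean.geometry (Fin 3)) σ (fun s => (Ψ m).flow s z') j ∩ Set.Ioc 0 Δ).ncard}.indicator
        1 z' * ENNReal.ofReal ‖w - ((Ψ m).flow t z' j).2‖ = ∑ j ∈ B, ENNReal.ofReal ‖w - ((Ψ m).flow t z' j).2‖ := by
    rw [hB, Finset.sum_filter]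
    refine Finset.sum_congr rfl fun j _ => ?_
    by_cases hj : IsFreeIn Ψ Δ z' j
    · rw [if_neg (not_not.2 hj), indicator_of_notMem, zero_mul]
      exact fun h => (not_isFreeIn_iff_ncard_pos Ψ hz' j Δ).2 h.2 hj
    · have hmem : z' ∈ {z' : Cell m | z' ∈ (Ψ m).good ∧
          0 < (collisionTimesOf (Euclidean.geometry (Fin 3)) σ (fun s => (Ψ m).flow s z') j ∩ Set.Ioc 0 Δ).ncard} :=
        ⟨hz', (not_isFreeIn_iff_ncard_pos Ψ hz' j Δ).1 hj⟩
      rw [if_pos hj, indicator_of_mem hmem, Pi.one_apply, one_mul]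
  have hrhs : (∑ j : Fin m, if IsFreeIn Ψ Δ z' j then 0 else ENNReal.ofReal (1 + ‖(z' j).2‖ ^ 2)) =
      ∑ j ∈ B, ENNReal.ofReal (1 + ‖(z' j).2‖ ^ 2) := by
    rw [hB, Finset.sum_filter]
    refine Finset.sum_congr rfl fun j _ => ?_
    by_cases hj : IsFreeIn Ψ Δ z' j
    · rw [if_pos hj, if_neg (not_not.2 hj)]
    · rw [if_neg hj, if_pos hj]
  rw [hlhs, hrhs, ← ENNReal.ofReal_sum_of_nonneg (fun _ _ => norm_nonneg _),
    ← ENNReal.ofReal_sum_of_nonneg (fun _ _ => by positivity), ← ENNReal.ofReal_mul (by positivity)]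
  refine ENNReal.ofReal_le_ofReal ?_
  have hcard : (B.card : ℝ) ≤ ∑ j ∈ B, (1 + ‖(z' j).2‖ ^ 2) := by
    rw [Finset.card_eq_sum_ones, Nat.cast_sum]
    exact Finset.sum_le_sum fun j _ => by push_cast; nlinarith [sq_nonneg ‖(z' j).2‖]
  calc ∑ j ∈ B, ‖w - ((Ψ m).flow t z' j).2‖ ≤ ∑ j ∈ B, (‖w‖ + (1 + ‖((Ψ m).flow t z' j).2‖ ^ 2)) :=
        Finset.sum_le_sum fun j _ => (norm_sub_le _ _).trans (by
          nlinarith [sq_nonneg (‖((Ψ m).flow t z' j).2‖ - 1), norm_nonneg ((Ψ m).flow t z' j).2])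
    _ = B.card * ‖w‖ + (∑ j ∈ B, (1 : ℝ) + ∑ j ∈ B, ‖((Ψ m).flow t z' j).2‖ ^ 2) := by
        rw [Finset.sum_add_distrib, Finset.sum_add_distrib, Finset.sum_const, nsmul_eq_mul]
    _ = B.card * ‖w‖ + ∑ j ∈ B, (1 + ‖(z' j).2‖ ^ 2) := by rw [henergy, ← Finset.sum_add_distrib]
    _ ≤ (∑ j ∈ B, (1 + ‖(z' j).2‖ ^ 2)) * ‖w‖ + ∑ j ∈ B, (1 + ‖(z' j).2‖ ^ 2) :=
        add_le_add (mul_le_mul_of_nonneg_right hcard (norm_nonneg w)) le_rfl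
    _ = (‖w‖ + 1) * ∑ j ∈ B, (1 + ‖(z' j).2‖ ^ 2) := by ring

/-- The Maxwellian moment `E[‖w‖ + 1]` is finite. [folklore] -/
theorem lintegral_norm_add_one_lt_top : ∫⁻ w, ENNReal.ofReal (‖w‖ + 1) ∂stdGaussian V3 < ∞ := by
  have hint : Integrable (fun w : V3 => 2 + ‖w‖ ^ 2) (stdGaussian V3) :=
    (integrable_const 2).add integrable_norm_sq_stdGaussian
  refine lt_of_le_of_lt (lintegral_mono fun w => ENNReal.ofReal_le_ofReal ?_) hint.lintegral_lt_top
  nlinarith [sq_nonneg (‖w‖ - 1), norm_nonneg w]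

/-- Bookkeeping of the constants: `(m+1) · 2 L⁻³ σ² Δ S · K C_A L³ Δ ≤ 4 σ² S K C_A (L³Δ² + L²Δ)` for `m + 1 ≤ 2L³`.
[folklore] -/
theorem nonFresh_bookkeeping {Δ : ℝ} (hL : 1 ≤ L) (hΔ : 0 ≤ Δ) (hm : ((m + 1 : ℕ) : ℝ) ≤ 2 * L ^ 3)
    {S K : ℝ≥0∞} (hS : S ≠ ∞) (hK : K ≠ ∞) {CA : ℝ} (hCA : 0 ≤ CA) :
    ((m + 1 : ℕ) : ℝ≥0∞) * (2 * (ENNReal.ofReal ((L ^ 3)⁻¹) * ENNReal.ofReal (σ ^ 2 * Δ) * S) *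
        (K * ENNReal.ofReal (CA * L ^ 3 * Δ))) ≤
      ENNReal.ofReal (4 * σ ^ 2 * S.toReal * K.toReal * CA * (L ^ 3 * Δ ^ 2 + L ^ 2 * Δ)) := by
  have hL0 : 0 < L := one_pos.trans_le hL
  have hfin : ((m + 1 : ℕ) : ℝ≥0∞) * (2 * (ENNReal.ofReal ((L ^ 3)⁻¹) * ENNReal.ofReal (σ ^ 2 * Δ) * S) *
      (K * ENNReal.ofReal (CA * L ^ 3 * Δ))) ≠ ∞ :=
    ENNReal.mul_ne_top (ENNReal.natCast_ne_top _) (ENNReal.mul_ne_top (ENNReal.mul_ne_top ENNReal.ofNat_ne_top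
      (ENNReal.mul_ne_top (ENNReal.mul_ne_top ENNReal.ofReal_ne_top ENNReal.ofReal_ne_top) hS))
      (ENNReal.mul_ne_top hK ENNReal.ofReal_ne_top))
  rw [ENNReal.le_ofReal_iff_toReal_le hfin (by positivity)]
  simp only [ENNReal.toReal_mul, ENNReal.toReal_natCast, ENNReal.toReal_ofNat,
    ENNReal.toReal_ofReal (inv_nonneg.2 (pow_nonneg hL0.le 3)), ENNReal.toReal_ofReal (by positivity : 0 ≤ σ ^ 2 * Δ),
    ENNReal.toReal_ofReal (by positivity : 0 ≤ CA * L ^ 3 * Δ)]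
  have hmm : ((m + 1 : ℕ) : ℝ) * (L ^ 3)⁻¹ ≤ 2 := by
    rw [mul_inv_le_iff₀ (pow_pos hL0 3)]
    linarith
  have hslack : 0 ≤ 4 * σ ^ 2 * S.toReal * K.toReal * CA * (L ^ 2 * Δ) := by positivity
  calc ((m + 1 : ℕ) : ℝ) * (2 * ((L ^ 3)⁻¹ * (σ ^ 2 * Δ) * S.toReal) * (K.toReal * (CA * L ^ 3 * Δ)))
      = (((m + 1 : ℕ) : ℝ) * (L ^ 3)⁻¹) * (2 * (σ ^ 2 * S.toReal * K.toReal * CA * (L ^ 3 * Δ ^ 2))) := by ring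
    _ ≤ 2 * (2 * (σ ^ 2 * S.toReal * K.toReal * CA * (L ^ 3 * Δ ^ 2))) :=
        mul_le_mul_of_nonneg_right hmm (by positivity)
    _ ≤ 4 * σ ^ 2 * S.toReal * K.toReal * CA * (L ^ 3 * Δ ^ 2 + L ^ 2 * Δ) := by nlinarith

/-! ## The charging functional of the non-fresh bound and its expectation -/

open Classical in
/-- **Expectation of the non-fresh charging count at mesh `M`**: for every label `i` and mesh `M`,
`E_{P_{m+1,L}} ∑_{k<M} ∑ⱼ 1{j not free for the bath without i} 1_{Cyl(Δ/M)}(xᵢ + a_k vᵢ − Xⱼ(a_k), vᵢ − Vⱼ(a_k)) ≤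
2 L⁻³ σ² Δ |S²| · E[‖w‖ + 1] · (C_A L³ Δ)`, given the weighted first-order bound `C_A L³ Δ` for the `m`-system
(integrated charging bound at each grid time, energy of the non-free spheres, `M · (Δ/M) = Δ`). [cite: CIP1994, App. 4.A] -/
theorem lintegral_nonFreshCharging_le (hσ : 0 < σ) (hσ' : σ ≤ 3 / 16) (hfac : CellLawFactorises σ) (hL : 1 ≤ L)
    (hm : ((m + 1 : ℕ) : ℝ) ≤ 2 * L ^ 3) (Ψ : Flows σ) (i : Fin (m + 1)) {Δ : ℝ} (hΔ : 0 < Δ) {CA : ℝ}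
    (hCA : ∫⁻ z', ∑ j : Fin m, (if IsFreeIn Ψ Δ z' j then 0 else ENNReal.ofReal (1 + ‖(z' j).2‖ ^ 2))
      ∂cellLaw σ L m Ψ ≤ ENNReal.ofReal (CA * L ^ 3 * Δ)) (M : ℕ) :
    ∫⁻ z, ∑ k ∈ Finset.range M, 1 * ∑ j : Fin m, {z' : Cell m | z' ∈ (Ψ m).good ∧
        0 < (collisionTimesOf (Euclidean.geometry (Fin 3)) σ (fun s => (Ψ m).flow s z') j ∩ Set.Ioc 0 Δ).ncard}.indicator
          1 (fun c => z (i.succAbove c)) *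
        {p : V3 × V3 | PairHits σ p.1 p.2 ∧ 0 < pairDisc σ p.1 p.2 ∧ pairHitTime σ p.1 p.2 ∈ Set.Ioc 0 (Δ / M)}.indicator 1
          ((z i).1 + ((k : ℝ) * (Δ / M)) • (z i).2 - ((Ψ m).flow ((k : ℝ) * (Δ / M)) (fun c => z (i.succAbove c)) j).1,
            (z i).2 - ((Ψ m).flow ((k : ℝ) * (Δ / M)) (fun c => z (i.succAbove c)) j).2) ∂cellLaw σ L (m + 1) Ψ ≤
      2 * (ENNReal.ofReal ((L ^ 3)⁻¹) * ENNReal.ofReal (σ ^ 2 * Δ) * sphereMeasure (Set.univ : Set (Metric.sphere (0 : V3) 1))) *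
        ((∫⁻ w, ENNReal.ofReal (‖w‖ + 1) ∂stdGaussian V3) * ENNReal.ofReal (CA * L ^ 3 * Δ)) := by
  set S : ℝ≥0∞ := sphereMeasure (Set.univ : Set (Metric.sphere (0 : V3) 1)) with hSdef
  set R : Set (V3 × V3) := {p : V3 × V3 | PairHits σ p.1 p.2 ∧ 0 < pairDisc σ p.1 p.2 ∧
    pairHitTime σ p.1 p.2 ∈ Set.Ioc 0 (Δ / M)} with hRdef
  set K₁ : ℝ≥0∞ := ∫⁻ w, ENNReal.ofReal (‖w‖ + 1) ∂stdGaussian V3 with hK₁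
  have hR : MeasurableSet R := measurableSet_cylRel σ (Δ / M)
  have hh : 0 ≤ Δ / M := div_nonneg hΔ.le (Nat.cast_nonneg M)
  have hvol : ∀ u c : V3, ∫⁻ y, R.indicator 1 (y - c, u) ≤ ENNReal.ofReal (σ ^ 2 * (Δ / M) * ‖u‖) * S :=
    fun u c => lintegral_indicator_cylRel_sub_le hσ (Δ / M) u c
  have hWt : Measurable fun _ : V3 => (1 : ℝ≥0∞) := measurable_const
  have hWb : ∀ j : Fin m, Measurable fun z' : Cell m => {z' : Cell m | z' ∈ (Ψ m).good ∧
      0 < (collisionTimesOf (Euclidean.geometry (Fin 3)) σ (fun s => (Ψ m).flow s z') j ∩ Set.Ioc 0 Δ).ncard}.indicator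
        (1 : Cell m → ℝ≥0∞) z' :=
    fun j => measurable_one.indicator (measurableSet_good_and_ncard_pos Ψ m j Δ)
  -- each grid time contributes the same bound
  have hk : ∀ k ∈ Finset.range M, ∫⁻ z, 1 * ∑ j : Fin m, {z' : Cell m | z' ∈ (Ψ m).good ∧
      0 < (collisionTimesOf (Euclidean.geometry (Fin 3)) σ (fun s => (Ψ m).flow s z') j ∩ Set.Ioc 0 Δ).ncard}.indicator
        1 (fun c => z (i.succAbove c)) *
      R.indicator 1 ((z i).1 + ((k : ℝ) * (Δ / M)) • (z i).2 -
        ((Ψ m).flow ((k : ℝ) * (Δ / M)) (fun c => z (i.succAbove c)) j).1,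
        (z i).2 - ((Ψ m).flow ((k : ℝ) * (Δ / M)) (fun c => z (i.succAbove c)) j).2) ∂cellLaw σ L (m + 1) Ψ ≤
      2 * (ENNReal.ofReal ((L ^ 3)⁻¹) * ENNReal.ofReal (σ ^ 2 * (Δ / M)) * S) * (K₁ * ENNReal.ofReal (CA * L ^ 3 * Δ)) := by
    intro k hk
    have ha0 : 0 ≤ (k : ℝ) * (Δ / M) := mul_nonneg (Nat.cast_nonneg k) hh
    have haΔ : (k : ℝ) * (Δ / M) ≤ Δ := by
      have hkM : (k : ℝ) < M := by exact_mod_cast Finset.mem_range.1 hk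
      have hM : (0 : ℝ) < M := (Nat.cast_nonneg k).trans_lt hkM
      rw [← mul_div_assoc, div_le_iff₀ hM]
      nlinarith
    refine (lintegral_chargingTerm_le hσ hσ' hfac hL hm Ψ i hR hh sphereMeasure_univ_ne_top hvol
      (Wt := fun _ : V3 => (1 : ℝ≥0∞)) hWt hWb _).trans ?_
    refine mul_le_mul' le_rfl ?_
    calc ∫⁻ w, 1 * ∫⁻ z', ∑ j : Fin m, {z' : Cell m | z' ∈ (Ψ m).good ∧
            0 < (collisionTimesOf (Euclidean.geometry (Fin 3)) σ (fun s => (Ψ m).flow s z') j ∩ Set.Ioc 0 Δ).ncard}.indicator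
              1 z' * ENNReal.ofReal ‖w - ((Ψ m).flow ((k : ℝ) * (Δ / M)) z' j).2‖ ∂cellLaw σ L m Ψ ∂stdGaussian V3
        ≤ ∫⁻ w, ENNReal.ofReal (‖w‖ + 1) * ENNReal.ofReal (CA * L ^ 3 * Δ) ∂stdGaussian V3 := by
          refine lintegral_mono fun w => ?_
          rw [one_mul]
          calc _ ≤ ∫⁻ z', ENNReal.ofReal (‖w‖ + 1) * ∑ j : Fin m,
                (if IsFreeIn Ψ Δ z' j then 0 else ENNReal.ofReal (1 + ‖(z' j).2‖ ^ 2)) ∂cellLaw σ L m Ψ :=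
                lintegral_mono_ae ((ae_mem_good_cellLaw σ L m Ψ).mono fun z' hz' =>
                  sum_indicator_norm_sub_vel_le Ψ hz' ⟨ha0, haΔ⟩ w)
            _ ≤ ENNReal.ofReal (‖w‖ + 1) * ENNReal.ofReal (CA * L ^ 3 * Δ) := by
                rw [lintegral_const_mul' _ _ ENNReal.ofReal_ne_top]
                exact mul_le_mul' le_rfl hCA
      _ = K₁ * ENNReal.ofReal (CA * L ^ 3 * Δ) := by
          rw [lintegral_mul_const' _ _ ENNReal.ofReal_ne_top]
  -- sum over the grid
  rw [lintegral_finsetSum _ fun k _ => measurable_chargingTerm Ψ i hR hWt hWb _]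
  refine (Finset.sum_le_sum hk).trans ?_
  rw [Finset.sum_const, Finset.card_range, nsmul_eq_mul]
  have hMΔ : (M : ℝ≥0∞) * ENNReal.ofReal (σ ^ 2 * (Δ / M)) ≤ ENNReal.ofReal (σ ^ 2 * Δ) := by
    rw [← ENNReal.ofReal_natCast, ← ENNReal.ofReal_mul (Nat.cast_nonneg M)]
    refine ENNReal.ofReal_le_ofReal ?_
    rcases Nat.eq_zero_or_pos M with hM | hM
    · subst hM
      simp only [Nat.cast_zero, div_zero, mul_zero]
      positivity
    · have hM' : (M : ℝ) ≠ 0 := by exact_mod_cast hM.ne'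
      calc (M : ℝ) * (σ ^ 2 * (Δ / M)) = σ ^ 2 * (Δ / M * M) := by ring
        _ = σ ^ 2 * Δ := by rw [div_mul_cancel₀ _ hM']
        _ ≤ σ ^ 2 * Δ := le_rfl
  calc (M : ℝ≥0∞) * (2 * (ENNReal.ofReal ((L ^ 3)⁻¹) * ENNReal.ofReal (σ ^ 2 * (Δ / M)) * S) *
        (K₁ * ENNReal.ofReal (CA * L ^ 3 * Δ)))
      = 2 * (ENNReal.ofReal ((L ^ 3)⁻¹) * ((M : ℝ≥0∞) * ENNReal.ofReal (σ ^ 2 * (Δ / M))) * S) *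
        (K₁ * ENNReal.ofReal (CA * L ^ 3 * Δ)) := by ring
    _ ≤ _ := by gcongr

/-! ## The registered sub-goal -/

open Classical in
/-- **Registered sub-goal `stub_clusterTail_nonFresh`** (S2e-2, piece of stub `stub_clusterTail` of the line
`enskog-compensator-martingale`): **non-fresh first contacts are second order.** For `0 < σ ≤ 3/16` there is `C` such
that for `L ≥ 1`, `n ≤ 2L³`, every cluster dynamics and `Δ ∈ (0, 1]`, the expected number of spheres `i` that are free
on `(0, s)` and collide at a time `s ≤ Δ` with a sphere `j` which already took part in a collision at a time `< s` is
`≤ C (L³Δ² + L²Δ)`: the first contact of `i` is charged at a grid time to a Boltzmann cylinder around a NON-FREE sphere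
of the bath evolved without `i` (Fatou over the meshes, insertion inequality, Tonelli over the inserted position), and
the non-free spheres of the bath, a collision-closed group, carry their initial energy, so that the bath factor is the
weighted first-order bound `stub_clusterTail_firstOrder` of the `(n−1)`-system, `O(L³Δ)`. [cite: CIP1994, App. 4.A] -/
theorem stub_clusterTail_nonFresh : ∀ σ : ℝ, 0 < σ → σ ≤ 3 / 16 → CellLawFactorises σ →
    ∃ C : ℝ, 0 ≤ C ∧ ∀ L : ℝ, 1 ≤ L → ∀ n : ℕ, (n : ℝ) ≤ 2 * L ^ 3 → ∀ (Ψ : Flows σ) (Δ : ℝ), 0 < Δ → Δ ≤ 1 →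
      ∫⁻ z, ((Finset.univ.filter fun i : Fin n => ∃ j : Fin n, j ≠ i ∧ ∃ s ∈ Set.Ioc 0 Δ,
          Collide (Euclidean.geometry (Fin 3)) σ ((Ψ n).flow s z) i j ∧
          (∀ s' ∈ Set.Ioo 0 s, ¬ Participates (Euclidean.geometry (Fin 3)) σ ((Ψ n).flow s' z) i) ∧
          (∃ s' ∈ Set.Ioo 0 s, Participates (Euclidean.geometry (Fin 3)) σ ((Ψ n).flow s' z) j)).card : ℝ≥0∞)
          ∂(cellLaw σ L n Ψ) ≤ ENNReal.ofReal (C * (L ^ 3 * Δ ^ 2 + L ^ 2 * Δ)) := by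
  intro σ hσ hσ' hfac
  obtain ⟨CA, hCA0, hA⟩ := stub_clusterTail_firstOrder σ hσ hσ' hfac
  set S : ℝ≥0∞ := sphereMeasure (Set.univ : Set (Metric.sphere (0 : V3) 1)) with hSdef
  set K₁ : ℝ≥0∞ := ∫⁻ w, ENNReal.ofReal (‖w‖ + 1) ∂stdGaussian V3 with hK₁def
  have hS : S ≠ ∞ := sphereMeasure_univ_ne_top
  have hK : K₁ ≠ ∞ := lintegral_norm_add_one_lt_top.ne
  refine ⟨4 * σ ^ 2 * S.toReal * K₁.toReal * CA, by positivity, ?_⟩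
  intro L hL n hn Ψ Δ hΔ hΔ1
  cases n with
  | zero => simp
  | succ m =>
    have hm0 : (m : ℝ) ≤ 2 * L ^ 3 := le_trans (by exact_mod_cast Nat.le_succ m) hn
    have hAm := hA L hL m hm0 Ψ Δ hΔ hΔ1
    -- the measurable charging functionals
    set G : ℕ → Cell (m + 1) → ℝ≥0∞ := fun M z => ∑ i : Fin (m + 1), ∑ k ∈ Finset.range M,
      1 * ∑ j : Fin m, {z' : Cell m | z' ∈ (Ψ m).good ∧
        0 < (collisionTimesOf (Euclidean.geometry (Fin 3)) σ (fun s => (Ψ m).flow s z') j ∩ Set.Ioc 0 Δ).ncard}.indicator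
          1 (fun c => z (i.succAbove c)) *
        {p : V3 × V3 | PairHits σ p.1 p.2 ∧ 0 < pairDisc σ p.1 p.2 ∧ pairHitTime σ p.1 p.2 ∈ Set.Ioc 0 (Δ / M)}.indicator 1
          ((z i).1 + ((k : ℝ) * (Δ / M)) • (z i).2 - ((Ψ m).flow ((k : ℝ) * (Δ / M)) (fun c => z (i.succAbove c)) j).1,
            (z i).2 - ((Ψ m).flow ((k : ℝ) * (Δ / M)) (fun c => z (i.succAbove c)) j).2) with hGdef
    have hWb : ∀ j : Fin m, Measurable fun z' : Cell m => {z' : Cell m | z' ∈ (Ψ m).good ∧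
        0 < (collisionTimesOf (Euclidean.geometry (Fin 3)) σ (fun s => (Ψ m).flow s z') j ∩ Set.Ioc 0 Δ).ncard}.indicator
          (1 : Cell m → ℝ≥0∞) z' :=
      fun j => measurable_one.indicator (measurableSet_good_and_ncard_pos Ψ m j Δ)
    have hGm : ∀ M, Measurable (G M) := fun M =>
      Finset.measurable_sum _ fun i _ => Finset.measurable_sum _ fun k _ =>
        measurable_chargingTerm Ψ i (measurableSet_cylRel σ (Δ / M)) (Wt := fun _ : V3 => (1 : ℝ≥0∞))
          measurable_const hWb _
    -- pathwise domination on the good sets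
    have hdom : ∀ᵐ z ∂cellLaw σ L (m + 1) Ψ,
        ((Finset.univ.filter fun i : Fin (m + 1) => ∃ j : Fin (m + 1), j ≠ i ∧ ∃ s ∈ Set.Ioc 0 Δ,
          Collide (Euclidean.geometry (Fin 3)) σ ((Ψ (m + 1)).flow s z) i j ∧
          (∀ s' ∈ Set.Ioo 0 s, ¬ Participates (Euclidean.geometry (Fin 3)) σ ((Ψ (m + 1)).flow s' z) i) ∧
          (∃ s' ∈ Set.Ioo 0 s, Participates (Euclidean.geometry (Fin 3)) σ ((Ψ (m + 1)).flow s' z) j)).card : ℝ≥0∞) ≤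
          liminf (fun M => G M z) atTop := by
      filter_upwards [ae_mem_good_cellLaw σ L (m + 1) Ψ,
        ae_all_iff.2 fun i => ae_removeNth_mem_good hσ hσ' hfac hL hn Ψ i] with z hz hz'
      rw [Finset.card_filter]
      push_cast
      have hev : ∀ i : Fin (m + 1), ∀ᶠ M : ℕ in atTop,
          (if ∃ j : Fin (m + 1), j ≠ i ∧ ∃ s ∈ Set.Ioc 0 Δ,
              Collide (Euclidean.geometry (Fin 3)) σ ((Ψ (m + 1)).flow s z) i j ∧
              (∀ s' ∈ Set.Ioo 0 s, ¬ Participates (Euclidean.geometry (Fin 3)) σ ((Ψ (m + 1)).flow s' z) i) ∧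
              (∃ s' ∈ Set.Ioo 0 s, Participates (Euclidean.geometry (Fin 3)) σ ((Ψ (m + 1)).flow s' z) j)
            then (1 : ℝ≥0∞) else 0) ≤
          ∑ k ∈ Finset.range M, 1 * ∑ j : Fin m, {z' : Cell m | z' ∈ (Ψ m).good ∧
            0 < (collisionTimesOf (Euclidean.geometry (Fin 3)) σ (fun s => (Ψ m).flow s z') j ∩ Set.Ioc 0 Δ).ncard}.indicator
              1 (fun c => z (i.succAbove c)) *
            {p : V3 × V3 | PairHits σ p.1 p.2 ∧ 0 < pairDisc σ p.1 p.2 ∧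
                pairHitTime σ p.1 p.2 ∈ Set.Ioc 0 (Δ / M)}.indicator 1
              ((z i).1 + ((k : ℝ) * (Δ / M)) • (z i).2 -
                  ((Ψ m).flow ((k : ℝ) * (Δ / M)) (fun c => z (i.succAbove c)) j).1,
                (z i).2 - ((Ψ m).flow ((k : ℝ) * (Δ / M)) (fun c => z (i.succAbove c)) j).2) := by
        intro i
        by_cases hE : ∃ j : Fin (m + 1), j ≠ i ∧ ∃ s ∈ Set.Ioc 0 Δ,
            Collide (Euclidean.geometry (Fin 3)) σ ((Ψ (m + 1)).flow s z) i j ∧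
            (∀ s' ∈ Set.Ioo 0 s, ¬ Participates (Euclidean.geometry (Fin 3)) σ ((Ψ (m + 1)).flow s' z) i) ∧
            (∃ s' ∈ Set.Ioo 0 s, Participates (Euclidean.geometry (Fin 3)) σ ((Ψ (m + 1)).flow s' z) j)
        swap
        · exact Eventually.of_forall fun M => by rw [if_neg hE]; exact zero_le
        obtain ⟨jj, hji, τ, hτ, hcol, hnp, s', hs', hpart⟩ := hE
        obtain ⟨j, rfl⟩ := Fin.exists_succAbove_eq hji
        have hnf : (fun c => z (i.succAbove c)) ∈ {z' : Cell m | z' ∈ (Ψ m).good ∧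
            0 < (collisionTimesOf (Euclidean.geometry (Fin 3)) σ (fun s => (Ψ m).flow s z') j ∩ Set.Ioc 0 Δ).ncard} := by
          refine ⟨hz' i, (not_isFreeIn_iff_ncard_pos Ψ (hz' i) j Δ).1 fun hfree => ?_⟩
          exact hfree s' ⟨hs'.1, hs'.2.le.trans hτ.2⟩
            (participates_bath_of_participates Ψ hz (hz' i) hnp hs' hpart)
        refine (eventually_exists_grid_charge hσ Ψ hz (hz' i) hτ hcol hnp).mono fun M hM => ?_
        obtain ⟨k, hkM, hmem⟩ := hM
        rw [if_pos ⟨i.succAbove j, hji, τ, hτ, hcol, hnp, s', hs', hpart⟩]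
        simp_rw [Finset.mul_sum]
        refine le_trans (le_of_eq ?_) (le_sum_sum_of_mem (Finset.mem_range.2 hkM) (Finset.mem_univ j))
        rw [indicator_of_mem hmem, indicator_of_mem hnf, Pi.one_apply, Pi.one_apply, mul_one, mul_one]
      refine le_liminf_of_le (h := (eventually_all.2 hev).mono fun M hM => ?_)
      exact Finset.sum_le_sum fun i _ => hM i
    -- expectation of the charging functionals, uniformly in the mesh
    have hB : ∀ M, ∫⁻ z, G M z ∂cellLaw σ L (m + 1) Ψ ≤ ((m + 1 : ℕ) : ℝ≥0∞) *
        (2 * (ENNReal.ofReal ((L ^ 3)⁻¹) * ENNReal.ofReal (σ ^ 2 * Δ) * S) * (K₁ * ENNReal.ofReal (CA * L ^ 3 * Δ))) := by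
      intro M
      simp only [hGdef]
      rw [lintegral_finsetSum _ fun i _ => Finset.measurable_sum _ fun k _ =>
        measurable_chargingTerm Ψ i (measurableSet_cylRel σ (Δ / M)) (Wt := fun _ : V3 => (1 : ℝ≥0∞))
          measurable_const hWb _]
      refine (Finset.sum_le_sum fun i _ => lintegral_nonFreshCharging_le hσ hσ' hfac hL hn Ψ i hΔ hAm M).trans ?_
      rw [Finset.sum_const, Finset.card_univ, Fintype.card_fin, nsmul_eq_mul]
    -- Fatou
    calc ∫⁻ z, ((Finset.univ.filter fun i : Fin (m + 1) => ∃ j : Fin (m + 1), j ≠ i ∧ ∃ s ∈ Set.Ioc 0 Δ,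
            Collide (Euclidean.geometry (Fin 3)) σ ((Ψ (m + 1)).flow s z) i j ∧
            (∀ s' ∈ Set.Ioo 0 s, ¬ Participates (Euclidean.geometry (Fin 3)) σ ((Ψ (m + 1)).flow s' z) i) ∧
            (∃ s' ∈ Set.Ioo 0 s, Participates (Euclidean.geometry (Fin 3)) σ ((Ψ (m + 1)).flow s' z) j)).card : ℝ≥0∞)
          ∂cellLaw σ L (m + 1) Ψ
        ≤ ∫⁻ z, liminf (fun M => G M z) atTop ∂cellLaw σ L (m + 1) Ψ := lintegral_mono_ae hdom
      _ ≤ liminf (fun M => ∫⁻ z, G M z ∂cellLaw σ L (m + 1) Ψ) atTop := lintegral_liminf_le hGm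
      _ ≤ ((m + 1 : ℕ) : ℝ≥0∞) *
          (2 * (ENNReal.ofReal ((L ^ 3)⁻¹) * ENNReal.ofReal (σ ^ 2 * Δ) * S) * (K₁ * ENNReal.ofReal (CA * L ^ 3 * Δ))) :=
        liminf_le_of_frequently_le' (Frequently.of_forall hB)
      _ ≤ ENNReal.ofReal (4 * σ ^ 2 * S.toReal * K₁.toReal * CA * (L ^ 3 * Δ ^ 2 + L ^ 2 * Δ)) :=
        nonFresh_bookkeeping hL hΔ.le hn hS hK hCA0

end Summit.AtomisticToContinuum.HydrodynamicLimit.Theorems.EnskogCompensator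

end
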